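import Summits.CriticalPhenomena.PercolationContinuityZ3.Theorems.PercNearOneGluingAdditiveGluingCAG
import HarnessLib

/-!
# Crux `PercNearOneGluing.AdditiveGluing` (stmt-CriticalPhenomena-4576): the crux needs CAG only for observers STRICTLY BELOW the relays

Support file (`--supports stmt-CriticalPhenomena-4576`, lead prim-png-lead-4576).  No definitions, no named facts, no sorries.

Refinement of `additiveGluing_of_cag` (p175486): the conditioned form CAG `μ(o↔A, o↮b, A↔b) ≤ μ(A↔b) − τ(a₀)` is only needed for
observers `o` with `τ(o) < τ(a₀) = min_A τ` — for `τ(o) ≥ min_A τ ≥ 1 − t` the crux inequality is trivial.  This is the form in which the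
"gain" conjectures of the lead's memos are sharp (LeadMath-prim6 + addendum: for modified sets of size ≥ 4 the hypothesis "observer strictly
below the set" is necessary and exactly sharp on the hub-with-gateway family), so the official reduction should not ask for more.
[cite: KozmaNitzan2024, Lemma 4 (p. 9), Question 7 (p. 36)]
-/

namespace Summit.CriticalPhenomena.PercolationContinuityZ3.Theorems

open MeasureTheory Set Literature.Probability.LatticeModels Literature.Probability.Percolation

noncomputable section
open Classical

/-- **CAG for observers strictly below the relays implies the crux.** [cite: KozmaNitzan2024, Lemma 4 (p. 9), Question 7 (p. 36)] -/
theorem additiveGluing_of_cagLow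
    (hcag : ∀ (n : ℕ) (w : Sym2 (Fin n) → unitInterval) (A : Finset (Fin n)) (o b a₀ : Fin n),
      a₀ ∈ A → (∀ a ∈ A, (prodBernoulli w).real (openConn a₀ b) ≤ (prodBernoulli w).real (openConn a b)) →
      (prodBernoulli w).real (openConn o b) < (prodBernoulli w).real (openConn a₀ b) →
      (prodBernoulli w).real ((⋃ a ∈ A, openConn o a) ∩ (openConn o b)ᶜ ∩ (⋃ a ∈ A, openConn a b)) ≤
        (prodBernoulli w).real (⋃ a ∈ A, openConn a b) - (prodBernoulli w).real (openConn a₀ b)) :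
    Summit.CriticalPhenomena.PercolationContinuityZ3.Theses.PercNearOneGluing.AdditiveGluing := by
  intro n w A o b t ht hrel
  have hm : ∀ s : Set (BondConfig (Fin n)), MeasurableSet s := fun _ => MeasurableSet.of_discrete
  set OA : Set (BondConfig (Fin n)) := ⋃ a ∈ A, openConn o a with hOA
  set Ob : Set (BondConfig (Fin n)) := openConn o b with hOb
  set AB : Set (BondConfig (Fin n)) := ⋃ a ∈ A, openConn a b with hAB
  by_cases hA : A = ∅
  · have h0 : (prodBernoulli w).real OA = 0 := by
      rw [hOA, hA]; simp
    have hnn : 0 ≤ (prodBernoulli w).real Ob := measureReal_nonneg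
    linarith
  obtain ⟨a₀, ha₀, hmin⟩ := Finset.exists_min_image A (fun a => (prodBernoulli w).real (openConn a b))
    (Finset.nonempty_of_ne_empty hA)
  have h5 := hrel a₀ ha₀
  have hOA1 : (prodBernoulli w).real OA ≤ 1 := measureReal_le_one
  by_cases hlow : (prodBernoulli w).real (openConn o b) < (prodBernoulli w).real (openConn a₀ b)
  swap
  · -- observer at least as reliable as the worst relay: trivial
    push Not at hlow
    have : (prodBernoulli w).real Ob = (prodBernoulli w).real (openConn o b) := rfl
    linarith
  have hc := hcag n w A o b a₀ ha₀ hmin hlow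
  have h1 : (prodBernoulli w).real OA ≤ (prodBernoulli w).real (OA ∩ Obᶜ) + (prodBernoulli w).real Ob := by
    have hsub : OA ⊆ (OA ∩ Obᶜ) ∪ Ob := by
      intro ω hω
      by_cases hb : ω ∈ Ob
      · exact Or.inr hb
      · exact Or.inl ⟨hω, hb⟩
    exact (measureReal_mono hsub (measure_ne_top _ _)).trans (measureReal_union_le _ _)
  have h2 := measureReal_inter_add_sdiff (μ := prodBernoulli w) (s := OA ∩ Obᶜ) (hm AB)
  have h3 : (prodBernoulli w).real ((OA ∩ Obᶜ) \ AB) ≤ (prodBernoulli w).real ABᶜ :=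
    measureReal_mono (fun ω hω => hω.2) (measure_ne_top _ _)
  have h4 : (prodBernoulli w).real ABᶜ = 1 - (prodBernoulli w).real AB := probReal_compl_eq_one_sub (hm _)
  linarith

end

end Summit.CriticalPhenomena.PercolationContinuityZ3.Theorems
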